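import Mathlib.Data.Matrix.Basic
import Mathlib.Tactic
import Summits.Ventures.HSemireg.SchoenCycleCupDerivation
import HarnessLib

/-!
# Venture HSemireg — STEP-0 class (A): Schoen's cycle CARRIES the Weil class — `[Z] = ⅙ω_K² + w`, `w ∈ W_K ∖ 0`, kernel-checked

HONEST FRAMING. Third file of seat s0-1's Lean record of the cell's STEP-0 class (A) row (computation cell `pub-hsemireg`);
companion of `SchoenCycleCupCertificate.lean` (rank of `ξ ↦ ξ ∪ [Z]`) and `SchoenCycleCupDerivation.lean` (the computable model
`Λ^•ℤ⁸` of `H^•(J × J)` and the class `2[Z]`). Here: the CLASS leg. In the same model, with coefficients extended to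
`ℤ[s]`, `s² = −3` (pairs `(a, b) = a + b·s`), this file writes down (i) the `ℚ(√-3)`-structure of record on `X = J × J = J ⊗ ℤ²`
(`K = ℚ(√-3) ⊂ M₂(ℚ)` acting on the second factor; on generators `ζ^* e_i = −e_i + e_i′`, `ζ^* e_i′ = −e_i`, the reading of
[vanGeemen2022 §6.2]'s matrix that fixes `ω_K`, lead's SCHOEN-CLASS.md / RESULT-A S1), (ii) the four `ζ^*`-eigenvectors
`v_i = −2e_i + (1+s)e_i′` (`2ζ^*v_i = (−1+s)v_i`, checked), a `K`-basis of the eigenspace `V_ζ ⊂ H¹(X, K)` (dimension `4`),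
(iii) `Ω := v₀ ∧ v₁ ∧ v₂ ∧ v₃` (so `W_K ⊗ K = K·Ω ⊕ K·Ω̄` is the `2`-dimensional space of WEIL CLASSES of the Weil-type fourfold
`(X, K)` — this identification is the DEFINITION of `W_K = ∧⁴_K H¹(X,ℚ)` read through the eigenspace decomposition, and is the
dictionary, not a kernel fact), (iv) the `K`-hermitian polarisation class `ω_K = 2θ₁ − ω_σ + 2θ₂`, and PROVES BY KERNEL
EVALUATION: `16·(6·[Z] − ω_K²) = (1+s)·Ω + (1−s)·Ω̄` on every 4-monomial, both sides being 4-forms (so `[Z] = ⅙ω_K² + w`, `w = ((1+s)Ω + (1−s)Ω̄)/96` a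
NON-ZERO rational Weil class), together with the intersection numbers `Z·ω_K² = 36`, `ω_K⁴ = 216` (`36/216 = ⅙`), `Z² = 8` (top-degree pairings).
This is the «class-alive» half of the class-(A) row (the cycle's class has a non-zero component on the Weil classes of the split
`ℚ(√-3)` Weil-type component through `J × J`), reproduced by five codes in the cell; here it is a kernel fact about the stated
model. Nothing here is a statement about a variety beyond the dictionary of `SchoenCycleCupDerivation.lean` plus (i)–(iii);
nothing here says that HC / HC_CM / HC_AV holds. References: [Schoen1998HodgeWeilAddendum] §10; [vanGeemen1994HodgeAV] 5.2;
RESULT-A.md S1–S3.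
-/

namespace Summit.Ventures.HSemireg.SchoenCycle

/-! ## `ℤ[s]`-valued forms (`s² = −3`) -/

/-- `ℤ[s] = ℤ[√-3]` as pairs `(a, b) = a + b·s`. [folklore] -/
abbrev Zs : Type := ℤ × ℤ

/-- product in `ℤ[s]`: `(a + bs)(c + ds) = (ac − 3bd) + (ad + bc)s`. [folklore] -/
def zsMul (x y : Zs) : Zs := (x.1 * y.1 - 3 * x.2 * y.2, x.1 * y.2 + x.2 * y.1)
/-- conjugation `s ↦ −s`. [folklore] -/
def zsConj (x : Zs) : Zs := (x.1, -x.2)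

/-- `ℤ[s]`-valued forms on the bitmask monomials. [folklore] -/
abbrev FormS : Type := ℕ → Zs

/-- wedge product of `ℤ[s]`-valued forms (same merge-sign formula as `wedge`). [folklore] -/
def wedgeS (f g : FormS) : FormS := fun m =>
  ((submasks m).map (fun t => zsMul (eps t (m ^^^ t), 0) (zsMul (f t) (g (m ^^^ t))))).sum

/-! ## The `ℚ(√-3)`-structure of record and its eigenvectors -/

/-- `ζ^*` on the generators (`K = ℚ(√-3) ⊂ M₂(ℚ)` acting on `J ⊗ ℤ²`): `ζ^* e_i = −e_i + e_{i+4}` (`i < 4`), `ζ^* e_{i+4} = −e_i`,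
as `ℤ[s]`-valued 1-forms. [cite: Schoen1998HodgeWeilAddendum, §10] -/
def zetaGen (i : ℕ) : FormS := fun m =>
  if i < 4 then (if m = 2 ^ i then (-1, 0) else if m = 2 ^ (i + 4) then (1, 0) else (0, 0))
  else (if m = 2 ^ (i - 4) then (-1, 0) else (0, 0))

/-- `ζ^*` on a 1-form `f = Σ_j f(e_j) e_j`: `Σ_j f(e_j)·ζ^* e_j`. [folklore] -/
def zetaStar1 (f : FormS) : FormS := fun m =>
  ((List.range 8).map (fun j => zsMul (f (2 ^ j)) (zetaGen j m))).sum

/-- the eigenvectors `v_i = −2e_i + (1+s)e_{i+4}` (`i < 4`). [folklore] -/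
def vVec (i : ℕ) : FormS := fun m => if m = 2 ^ i then (-2, 0) else if m = 2 ^ (i + 4) then (1, 1) else (0, 0)

/-- `2·ζ^* v_i = (−1 + s)·v_i` for `i < 4`: the `v_i` lie in the `ζ_K = (−1+s)/2`-eigenspace `V_ζ` (and are `K`-independent:
`v_i` is the only one involving `e_i`). [folklore] -/
theorem vVec_eigen : ∀ i < 4, ∀ m < 256, zsMul (2, 0) (zetaStar1 (vVec i) m) = zsMul (-1, 1) (vVec i m) := by
  decide +kernel

/-- `Ω := (v₀ ∧ v₁) ∧ (v₂ ∧ v₃) ∈ Λ⁴` (a wedge of four 1-forms, hence a 4-form), a generator of `∧⁴_K V_ζ` (so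
`W_K ⊗ K = K·Ω ⊕ K·Ω̄`). [cite: vanGeemen1994HodgeAV, 5.2] -/
def Omega : FormS := wedgeS (wedgeS (vVec 0) (vVec 1)) (wedgeS (vVec 2) (vVec 3))

/-! ## The polarisation class `ω_K` and the decomposition of `[Z]` -/

/-- `ω_σ` as an explicit table (`65 = e₀e₆ ↦ 1, 20 = e₂e₄ ↦ −1, 130 = e₁e₇ ↦ 1, 40 = e₃e₅ ↦ −1`). [folklore] -/
def omegaSigmaFast : Form := fun m =>
  if m = 65 then 1 else if m = 20 then -1 else if m = 130 then 1 else if m = 40 then -1 else 0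

/-- the table is the wedge-built `ω_σ` of `SchoenCycleCupDerivation`. [folklore] -/
theorem omegaSigmaFast_eq : ∀ m < 256, omegaSigmaFast m = omegaSigma m := by
  decide +kernel

/-- `ω_K = 2θ₁ − ω_σ + 2θ₂`: the `K`-compatible polarisation class of the Weil-type structure (`E(ζx, ζy) = E(x, y)`;
RESULT-A S1, [vanGeemen2022 §6.2]). [cite: Schoen1998HodgeWeilAddendum, §10] -/
def omegaK : Form := fun m => 2 * theta1Fast m - omegaSigmaFast m + 2 * theta2Fast m

/-- `ω_K` is `ζ^*`-invariant on generators' level read as a 2-form identity: `ζ^*ω_K = ω_K`, checked through the induced action on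
2-forms `Σ f(e_ie_j) ζ^*e_i ∧ ζ^*e_j`. [folklore] -/
def zetaStar2 (f : Form) : FormS := fun m =>
  ((List.range 8).flatMap (fun i => (List.range 8).map (fun j =>
    if i < j then zsMul (f (2 ^ i + 2 ^ j), 0) (wedgeS (zetaGen i) (zetaGen j) m) else (0, 0)))).sum

/-- `ζ^* ω_K = ω_K` (so `ω_K` is a `K`-compatible class): checked on every 2-monomial; `ω_K` vanishes on all other monomials
(`omegaK_off2`), and `ζ^*` of a 2-form is a 2-form. [folklore] -/
theorem omegaK_invariant : ∀ m < 256, (gens m).length = 2 → zetaStar2 omegaK m = (omegaK m, 0) := by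
  decide +kernel

/-- `ω_K` is a 2-form: it vanishes off the 2-monomials. [folklore] -/
theorem omegaK_off2 : ∀ m < 256, (gens m).length ≠ 2 → omegaK m = 0 := by
  decide +kernel

/-- **The class decomposition.** On every 4-monomial: `16·(6·[Z] − ω_K ∧ ω_K) = (1+s)·Ω + (1−s)·Ω̄` (recall `twoZ = 2[Z]`);
both sides are 4-forms (`2[Z]` by `twoZ_type`; `ω_K ∧ ω_K` and `Ω = (v₀∧v₁)∧(v₂∧v₃)` as wedges of forms of pure degree — the
merge-sign formula only pairs `T ⊆ S` with `f(T)·g(S∖T) ≠ 0`), so the identity on 4-monomials is the identity of 4-forms. Hence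
`[Z] = ⅙ω_K² + w` with `w = ((1+s)Ω + (1−s)Ω̄)/96` — a RATIONAL class in `W_K ⊗ K = K·Ω ⊕ K·Ω̄`, i.e. a Weil class.
[cite: Schoen1998HodgeWeilAddendum, §10] -/
theorem class_decomposition : ∀ m < 256, (gens m).length = 4 →
    ((16 * (3 * twoZ m - wedge omegaK omegaK m) : ℤ), (0 : ℤ)) =
      zsMul (1, 1) (Omega m) + zsMul (1, -1) (zsConj (Omega m)) := by
  decide +kernel

/-- **The Weil part is non-zero**: `6[Z] − ω_K² ≠ 0` (witness: the monomial `e₁e₂e₃e₄`, mask `30`), and `Ω ≠ 0` (`Ω(e₀e₁e₂e₃) = 16`).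
[folklore] -/
theorem weilPart_ne_zero : 3 * twoZ 30 - wedge omegaK omegaK 30 ≠ 0 ∧ Omega 15 = (16, 0) := by
  decide +kernel

/-- the top-degree pairing of two 4-forms: the coefficient of `f ∧ g` on the top monomial `e₀∧…∧e₇` (mask `255`), summed over
the `70` splittings into 4-monomials (for 4-forms `f`, `g` this IS `wedge f g 255`; the restriction keeps the kernel evaluation small).
Orientation: `vol = ½θ₁² ∧ ½θ₂²` has top coefficient `1` (`twoZ_sq_top`). [folklore] -/
def pair4 (f g : Form) : ℤ :=
  (((submasks 255).filter (fun t => (gens t).length = 4)).map (fun t => eps t (255 ^^^ t) * f t * g (255 ^^^ t))).sum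

/-- **Intersection number `(2[Z])·ω_K² = 72`**, i.e. `Z·ω_K² = 36`. [folklore] -/
theorem pair_twoZ_omegaK2 : pair4 twoZ (wedge omegaK omegaK) = 72 := by
  decide +kernel

/-- **Intersection number `ω_K²·ω_K² = 216`**, i.e. `ω_K⁴ = 216`; with `Z·ω_K² = 36` the `ω_K²`-coefficient of `[Z]` is `36/216 = ⅙`
(`w ⊥ ω_K²`). [folklore] -/
theorem pair_omegaK2_omegaK2 : pair4 (wedge omegaK omegaK) (wedge omegaK omegaK) = 216 := by
  decide +kernel

/-- **Intersection number `(2[Z])·(2[Z]) = 32`**, i.e. `Z² = 8` (RESULT-A: `K_S² − c₂(S) = 16 − 8`). [folklore] -/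
theorem pair_twoZ_twoZ : pair4 twoZ twoZ = 32 := by
  decide +kernel

end Summit.Ventures.HSemireg.SchoenCycle
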